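import Mathlib
import Literature.NumberTheory.LFunctions.Zhang2022.Section16RhoTwo
import HarnessLib

/-!
# Zhang (2022), §16 p. 95: "`𝓡₂* = β₁ + O(1/𝓛¹⁰)`" from Lemma 5.8 and Lemma 5.4 (ii) — kernel edge

Topic `Literature/NumberTheory/LFunctions/Zhang2022` (Landau–Siegel audit tree; verdict-neutral).
Y. Zhang, *Discrete mean estimates and the Landau–Siegel zero*, arXiv:2211.02515v1 (2022)
[Zhang2022LandauSiegel] — **an unrefereed manuscript under adjudication**. §16 p. 95 (tex L4674–L4676,
DAG `Z22:§16.u043`, first half): "by Lemma 5.8 and direct calculation, `𝓡₂* = β₁ + O(1/𝓛¹⁰)`", where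
`𝓡₂* = L(1+β₁,χ)δ(1)/L′(1,χ)` (§16 p. 90; `Typed.Section16A.calR2star`; `δ` = the Mellin transform
(5.14), `Skeleton.deltaW`). PROVED here as a kernel EDGE from the skeleton node `Skeleton.Lemma54`
(Lemma 5.4 (ii): `δ(s) = 1 + O(α log 𝓛)` for `|s − 1| < 10α`, used at `s = 1`; a CLAIM node of the
skeleton, being discharged in layer L1) together with the tree's Lemma 5.8 (`Lemma58.lemma_5_8_of_le`,
at `1 + β₁`, `|β₁| ≤ 2α`) and Lemma 5.7 (`|L′(1,χ)| ≥ (4e)⁻¹`): `rhoStar_estimate`. The exact identity is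
`L(1+β₁)δ(1)/L′ − β₁ = β₁(δ(1) − 1) + [(L(1+β₁) − L′β₁)/L′]·δ(1)`, whence
`|𝓡₂* − β₁| ≤ 2α·Cα log 𝓛 + 4e·C₅₈𝓛⁻¹⁵(1 + Cπ) ≤ (2π²C + 4eC₅₈(1 + πC))𝓛⁻¹⁰`. Combined with
`rho2_estimate` (`Section16RhoTwo`) this yields the typed node `Typed.Section16B.Step16_u043` from
`Lemma54` (companion `Section16Eval1617Typed`). Nothing else is asserted; nothing about Theorems 1–2.

## References

* Y. Zhang, arXiv:2211.02515v1 (2022), §16 p. 90 (`𝓡₂*`), p. 95; §5 Lemmas 5.4, 5.7, 5.8.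
  [cite: Zhang2022LandauSiegel, §16 p.95]
-/

noncomputable section

open Complex Real

namespace Literature.NumberTheory.LFunctions.Zhang2022.Skeleton

variable (c' : ℝ)

/-- **"`𝓡₂* = β₁ + O(1/𝓛¹⁰)`", pointwise** (all inputs explicit): if `|δ − 1| ≤ Cαlog𝓛` (`C ≥ 0`),
`|L(1+β₁) − L′β₁| ≤ C₅₈𝓛⁻¹⁵`, `|L′| ≥ (4e)⁻¹`, `|β₁| ≤ 2α`, `α𝓛⁹ = π`, `𝓛 ≥ 1`, then
`|L(1+β₁)δ/L′ − β₁| ≤ (2π²C + 4eC₅₈(1+πC))𝓛⁻¹⁰`. [cite: Zhang2022LandauSiegel, §16 p.95] -/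
theorem rhoStar_core {D : ℕ} {L₁ L δ β₁ : ℂ} {C C₅₈ : ℝ} (hℓ1 : 1 ≤ ell D)
    (hα9 : alpha D * ell D ^ 9 = π) (hC : 0 ≤ C) (hC58 : 0 ≤ C₅₈)
    (hδ : ‖δ - 1‖ ≤ C * alpha D * Real.log (ell D)) (hE : ‖L₁ - L * β₁‖ ≤ C₅₈ / ell D ^ 15)
    (hL : 1 / (4 * Real.exp 1) ≤ ‖L‖) (hβ : ‖β₁‖ ≤ 2 * alpha D) :
    ‖L₁ / L * δ - β₁‖ ≤ (2 * π ^ 2 * C + 4 * Real.exp 1 * C₅₈ * (1 + π * C)) * (ell D ^ 10)⁻¹ := by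
  have hℓ0 : 0 < ell D := by linarith
  have hπ := Real.pi_pos
  have he := Real.exp_pos 1
  have hα := alpha_pos_of_ell_pos (D := D) hℓ0
  have hαeq : alpha D = π / ell D ^ 9 := by rw [← hα9]; field_simp
  have hL0 : L ≠ 0 := norm_pos_iff.mp (lt_of_lt_of_le (by positivity) hL)
  have hLpos : 0 < ‖L‖ := norm_pos_iff.mpr hL0
  -- `α log 𝓛 ≤ π 𝓛⁻⁸ ≤ π`
  have hlog : 0 ≤ Real.log (ell D) ∧ Real.log (ell D) ≤ ell D :=
    ⟨Real.log_nonneg hℓ1, (Real.log_le_sub_one_of_pos hℓ0).trans (by linarith)⟩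
  have hαlog : alpha D * Real.log (ell D) ≤ π * (ell D ^ 8)⁻¹ := by
    calc alpha D * Real.log (ell D) ≤ alpha D * ell D := by gcongr; exact hlog.2
      _ = π * (ell D ^ 8)⁻¹ := by rw [hαeq]; field_simp
  have h8 : (ell D ^ 8)⁻¹ ≤ 1 := inv_le_one_of_one_le₀ (one_le_pow₀ hℓ1)
  have hαlog' : alpha D * Real.log (ell D) ≤ π := by nlinarith
  -- the exact identity
  have hid : L₁ / L * δ - β₁ = β₁ * (δ - 1) + (L₁ - L * β₁) / L * δ := by
    field_simp; ring
  rw [hid]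
  have hδn : ‖δ‖ ≤ 1 + π * C := by
    calc ‖δ‖ = ‖(δ - 1) + 1‖ := by ring_nf
      _ ≤ ‖δ - 1‖ + ‖(1 : ℂ)‖ := norm_add_le _ _
      _ ≤ C * alpha D * Real.log (ell D) + 1 := by rw [norm_one]; gcongr
      _ = C * (alpha D * Real.log (ell D)) + 1 := by ring
      _ ≤ C * π + 1 := by gcongr
      _ = 1 + π * C := by ring
  have hterm1 : ‖β₁ * (δ - 1)‖ ≤ 2 * π ^ 2 * C * (ell D ^ 10)⁻¹ := by
    rw [norm_mul]
    calc ‖β₁‖ * ‖δ - 1‖ ≤ (2 * alpha D) * (C * alpha D * Real.log (ell D)) := by gcongr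
      _ = 2 * C * alpha D * (alpha D * Real.log (ell D)) := by ring
      _ ≤ 2 * C * alpha D * (π * (ell D ^ 8)⁻¹) := by gcongr
      _ = 2 * π ^ 2 * C * (ell D ^ 17)⁻¹ := by rw [hαeq]; field_simp
      _ ≤ 2 * π ^ 2 * C * (ell D ^ 10)⁻¹ :=
          mul_le_mul_of_nonneg_left (inv_anti₀ (by positivity) (pow_le_pow_right₀ hℓ1 (by norm_num)))
            (by positivity)
  have hterm2 : ‖(L₁ - L * β₁) / L * δ‖ ≤ 4 * Real.exp 1 * C₅₈ * (1 + π * C) * (ell D ^ 10)⁻¹ := by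
    rw [norm_mul, norm_div]
    have h1 : ‖L₁ - L * β₁‖ / ‖L‖ ≤ C₅₈ / ell D ^ 15 * (4 * Real.exp 1) := by
      rw [div_le_iff₀ hLpos]
      calc ‖L₁ - L * β₁‖ ≤ C₅₈ / ell D ^ 15 := hE
        _ = C₅₈ / ell D ^ 15 * (4 * Real.exp 1) * (1 / (4 * Real.exp 1)) := by field_simp
        _ ≤ C₅₈ / ell D ^ 15 * (4 * Real.exp 1) * ‖L‖ := by gcongr
    calc ‖L₁ - L * β₁‖ / ‖L‖ * ‖δ‖ ≤ C₅₈ / ell D ^ 15 * (4 * Real.exp 1) * (1 + π * C) := by gcongr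
      _ = 4 * Real.exp 1 * C₅₈ * (1 + π * C) * (ell D ^ 15)⁻¹ := by ring
      _ ≤ 4 * Real.exp 1 * C₅₈ * (1 + π * C) * (ell D ^ 10)⁻¹ :=
          mul_le_mul_of_nonneg_left (inv_anti₀ (by positivity) (pow_le_pow_right₀ hℓ1 (by norm_num)))
            (by positivity)
  calc ‖β₁ * (δ - 1) + (L₁ - L * β₁) / L * δ‖
      ≤ ‖β₁ * (δ - 1)‖ + ‖(L₁ - L * β₁) / L * δ‖ := norm_add_le _ _
    _ ≤ 2 * π ^ 2 * C * (ell D ^ 10)⁻¹ + 4 * Real.exp 1 * C₅₈ * (1 + π * C) * (ell D ^ 10)⁻¹ :=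
        add_le_add hterm1 hterm2
    _ = (2 * π ^ 2 * C + 4 * Real.exp 1 * C₅₈ * (1 + π * C)) * (ell D ^ 10)⁻¹ := by ring

/-- **§16 p. 95: "`𝓡₂* = β₁ + O(1/𝓛¹⁰)`"** (tex L4675, DAG `Z22:§16.u043`, first half;
`𝓡₂* = L(1+β₁,χ)δ(1)/L′(1,χ)`, p. 90), as a kernel EDGE from the skeleton node `Lemma54`
(Lemma 5.4 (ii) at `s = 1`) — the other inputs, Lemma 5.8 and Lemma 5.7, are theorems of the tree —
under (A), for all large `D`. [cite: Zhang2022LandauSiegel, §16 p.95] -/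
theorem rhoStar_estimate (h54 : Lemma54) : ∃ C : ℝ, ForAllLarge fun D _ χ => AssumptionA D χ →
    ‖χ.LFunction (1 + beta1 c' D) / deriv χ.LFunction 1 * deltaW D 1 - beta1 c' D‖ ≤
      C * (ell D ^ 10)⁻¹ := by
  obtain ⟨k, C54, D54, h54'⟩ := h54
  set C' : ℝ := max C54 0 with hC'
  have hC'0 : 0 ≤ C' := le_max_right _ _
  set C58 : ℝ := 1 + 16 * Real.exp (9 / 2) * π ^ 2 * 10 ^ 2 with hC58
  have hC58pos : 0 ≤ C58 := by positivity
  obtain ⟨Dl, hDl⟩ := self_div_totient_le_norm_deriv_L_one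
  obtain ⟨D₂, h₂⟩ := exists_forall_le_ell (max 3 (14 * π * |c'| + 1))
  refine ⟨2 * π ^ 2 * C' + 4 * Real.exp 1 * C58 * (1 + π * C'), max (max D₂ Dl) D54,
    fun D _ χ hD hq hp hA => ?_⟩
  have hT := h₂ D (le_trans (le_trans (le_max_left _ _) (le_max_left _ _)) hD)
  have hℓ3 : 3 ≤ ell D := le_trans (le_max_left _ _) hT
  have hℓc : 14 * π * |c'| + 1 ≤ ell D := le_trans (le_max_right _ _) hT
  have hℓ1 : 1 ≤ ell D := by linarith
  have hℓ0 : 0 < ell D := by linarith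
  have hα9 : alpha D * ell D ^ 9 = π := alpha_mul_ell_pow_nine hℓ0
  have hα : 0 < alpha D := alpha_pos_of_ell_pos hℓ0
  obtain ⟨-, h5⟩ := c_alpha_ell_small c' hℓ1 hℓc
  obtain ⟨-, hβ1u⟩ := norm_beta1_bounds c' hα.le (by positivity) h5
  -- Lemma 5.4 (ii) at `s = 1`
  obtain ⟨-, hδ⟩ := h54' D χ (le_trans (le_max_right _ _) hD) hq hp 1
  have hδ1 : ‖deltaW D 1 - 1‖ ≤ C' * alpha D * Real.log (ell D) := by
    have h := hδ (by rw [sub_self, norm_zero]; positivity)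
    refine h.trans ?_
    have : 0 ≤ alpha D * Real.log (ell D) := mul_nonneg hα.le (Real.log_nonneg hℓ1)
    calc C54 * alpha D * Real.log (ell D) = C54 * (alpha D * Real.log (ell D)) := by ring
      _ ≤ C' * (alpha D * Real.log (ell D)) := mul_le_mul_of_nonneg_right (le_max_left _ _) this
      _ = C' * alpha D * Real.log (ell D) := by ring
  -- Lemma 5.8 at `1 + β₁` and Lemma 5.7
  have h58 := lemma58_at_shift χ hp hℓ3 hA (z := beta1 c' D) (by linarith)
  have hLge := hDl D χ (le_trans (le_trans (le_max_right _ _) (le_max_left _ _)) hD) hq hp hA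
  have hD3 : 3 ≤ D := Section8Lemma82Steps.three_le_of_ell hℓ3
  have hφ1 : 1 ≤ (D : ℝ) / Nat.totient D := by
    rw [le_div_iff₀ (by exact_mod_cast Nat.totient_pos.mpr (by omega)), one_mul]
    exact_mod_cast Nat.totient_le D
  have hLlow : 1 / (4 * Real.exp 1) ≤ ‖deriv χ.LFunction 1‖ := by
    rw [div_le_iff₀ (by positivity)]; linarith [hLge, hφ1]
  exact rhoStar_core hℓ1 hα9 hC'0 hC58pos hδ1 h58 hLlow hβ1u

end Literature.NumberTheory.LFunctions.Zhang2022.Skeleton
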